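import Summits.BirchSwinnertonDyer.Rank1Residual.X2.GreenbergVatsalReductionDatumLine
import HarnessLib

/-!
# The local inertia group acts on the ordinary line `ker(E[p^k] → Ẽ)` through the cyclotomic
# character MOD `p^k`, at every level `k` (det `ρ_{E,p^k} = χ` on the ordinary filtration, Weil
# pairing) — kernel input of the UNIQUENESS of the ramified ordinary line (cell `b2b-bsdres`, lane
# CLASS-CLOSURE, seat cc-typer-2; team n1011 R5-47 (b): cc-typer-2 owner of `IsRamifiedOrdinaryLine`
# uniqueness)

HONEST FRAMING (cell `b2b-bsdres`, run/shared/lean/b2b/bsd-rank1-residual/, verbatim in every file):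
the goal of the cell is to DELETE the COMBINATION-SHAPED residual classes of the Birch–Swinnerton-Dyer
formula for ALL analytic-rank `≤ 1` elliptic curves over `ℚ` — assembled STRICTLY from published
theorems — so that the rank-`≤ 1` remainder becomes exactly the CONSTRUCTION-SHAPED classes, which are
TYPED (missing-input `Prop`s), NOT attempted. This is not "finishing BSD". Team n1011 / lane
CLASS-CLOSURE: research routes; no claim beyond stated classes; census output = EVIDENCE, never a
Literature fact; RESIDUAL-MAP marks UNCHANGED; nothing is booked by this file. Theorems only: NO
definition, NO named fact, NO conjecture node.

WHAT. X2's `GreenbergVatsalReductionDatumLine.exists_generator_and_inertia_smul_eq_two` is the level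
`k = 1` statement "`C[p] ≅ μ_p` as an `I_p`-module" (GV p. 26). This file is its level-`p^k` form, by
the same proof with `1 ↦ k`: for a globally minimal `E/ℚ`, a prime `p ∤ Δ_E` with `p ∤ a_p` and the
place `v ∋ p`, for every `k`,

* `exists_generator_inertia_smul_eq_cyclotomicCharacter` — a generator `P_k` of
  `ker red_v ∩ E(K̄_v)[p^k]` (cyclic of order `p^k`: the tree's ordinary filtration
  `localRed_ordinary_filtration` (i)) on which EVERY local inertia element `σ` acts by
  `χ_p(σ) mod p^k` (`σ P_k = (χ_p(σ) mod p^k) • P_k`): inertia acts on `P_k` by SOME scalar (it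
  preserves `ker red_v`, `localRed_smul_of_mem_absInertia`) and trivially on `E[p^k]/ℤP_k` (same
  lemma), so the Weil pairing at level `p^k` (`localPoints_exists_isPrimitiveRoot_smul_eq_pow`,
  Silverman III.8.1) produces a primitive `p^k`-th root of unity carrying the same scalars, which
  `GaloisRep.cyclotomicCharacter_spec` identifies with `χ_p mod p^k`;
* `exists_generator_and_inertia_smul_eq_of_not_dvd` — with `χ_p(I_{ℚ_v}) = ℤ_p^×`
  (`adicCompletion_rat_exists_mem_absInertia_cyclotomicCharacter_eq`, local Kronecker–Weber): for
  every `u ∈ ℕ` prime to `p` an inertia element acting on `P_k` as `u`;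
* `exists_generator_and_inertia_smul_eq_one_add` — the case `u = 1 + p` (an element of INFINITE
  order in `Aut C ≅ ℤ_p^×`, `p` odd), the input of the uniqueness theorem
  (`Additive/RamifiedOrdinaryLineUnique.lean`): no power `σ₁^N` acts trivially on `C[p^k]` once
  `p^k ∤ (1+p)^N − 1`.

References: Greenberg–Vatsal 2000 §2 p. 26 ("the inertia group `I_p` acts on `C` by the
`p`-cyclotomic character") [GreenbergVatsal2000]; Greenberg LNM 1716 §2 p. 70 (action on `ℱ[p^∞]` is
`φψ⁻¹`, `ψ|_{I_p} = χ|_{I_p}`) [GreenbergLNM1716]; Silverman *AEC* III.8.1, VII.2.1 [SilvermanAEC2009];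
Serre *Local Fields* IV §4 Prop. 17 [SerreLocalFields1979].
-/

noncomputable section

open scoped Classical AddSubgroup NNReal

open NumberField IsDedekindDomain Field
open Literature.NumberTheory.EllipticCurves Literature.NumberTheory.EllipticCurves.GreenbergSelmer
  Literature.NumberTheory.GaloisRepresentations IsDedekindDomain.HeightOneSpectrum
  Summit.BirchSwinnertonDyer.Rank1Residual.X2.GreenbergVatsalTorsion
  Summit.BirchSwinnertonDyer.Rank1Residual.X2.GreenbergVatsalReductionDatum
open WeierstrassCurve (minimalDiscriminantInt integralModelInt)

universe u

namespace Summit.BirchSwinnertonDyer.Rank1Residual.GaloisImage.OrdinaryLineInertiaCyclotomic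

variable (W : WeierstrassCurve ℚ) [W.IsGloballyMinimal] [W.IsElliptic] (p : ℕ) [hp : Fact p.Prime]
  {v : HeightOneSpectrum (𝓞 ℚ)}

/-- **Inertia acts on the level-`p^k` ordinary line through `χ_p mod p^k`.** For a globally minimal
`E/ℚ`, a prime `p ∤ Δ_E` with `p ∤ a_p` and the place `v ∋ p`, and any `k`: there is `P_k ∈ E(K̄_v)`
with `red_v P_k = 0`, of order `p^k`, generating `ker red_v ∩ E(K̄_v)[p^k]`, such that every element
`σ` of the local inertia group acts on `P_k` as the scalar `χ_p(σ) mod p^k`. (Weil pairing at level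
`p^k` + inertia acts trivially on `Ẽ`; GV p. 26, Greenberg LNM 1716 p. 70.)
[cite: GreenbergVatsal2000, §2 p. 26] [cite: SilvermanAEC2009, Prop. III.8.1] -/
theorem exists_generator_inertia_smul_eq_cyclotomicCharacter (hpv : ((p : ℕ) : 𝓞 ℚ) ∈ v.asIdeal)
    (hΔ : ¬ (p : ℤ) ∣ minimalDiscriminantInt W) (hord : ¬ (p : ℤ) ∣ W.frobeniusTrace p) (k : ℕ) :
    ∃ P : localPoints W (v.adicCompletion ℚ),
      localRed W p hpv hΔ P = 0 ∧ addOrderOf P = p ^ k ∧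
      (∀ Q : localPoints W (v.adicCompletion ℚ), localRed W p hpv hΔ Q = 0 →
        ((p ^ k : ℕ) : ℤ) • Q = 0 → ∃ j : ℕ, Q = j • P) ∧
      ∀ σ ∈ absInertia (v.adicCompletion ℚ),
        σ • P = ((GaloisRep.cyclotomicCharacter (v.adicCompletion ℚ) p σ).val.toZModPow k).val • P := by
  -- NB: no `CharZero (ℚ_v)` instance is put in scope (cf. X2 `GreenbergVatsalReductionDatumLine`).
  haveI : NeZero ((p : ℕ) : v.adicCompletion ℚ) := ⟨by
    rw [← map_natCast (algebraMap ℚ (v.adicCompletion ℚ))]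
    exact (map_ne_zero_iff _ (algebraMap ℚ (v.adicCompletion ℚ)).injective).mpr
      (Nat.cast_ne_zero.mpr hp.out.ne_zero)⟩
  set red := localRed W p hpv hΔ with hred
  have hΔu := W.isUnit_Δ_localIntModel hpv (specVal_spec v) hΔ
  have hvO : (specVal v).Integers (specVal v).valuationSubring :=
    Valuation.valuationSubring.integers (specVal v)
  -- residue characteristic `p`
  have hpO : specVal v ((p : ℕ) : AlgebraicClosure (v.adicCompletion ℚ)) < 1 := by
    have h := spectralValuation_algebraMap_ringOfIntegers_lt_one (v := v) (specVal_spec v) hpv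
    rwa [map_natCast] at h
  haveI hchar : CharP (IsLocalRing.ResidueField ↥(specVal v).valuationSubring) p := by
    refine (CharP.charP_iff_prime_eq_zero hp.out).mpr ?_
    rw [← map_natCast (IsLocalRing.residue ↥(specVal v).valuationSubring),
      IsLocalRing.residue_eq_zero_iff, IsLocalRing.mem_maximalIdeal, mem_nonunits_iff,
      hvO.isUnit_iff_valuation_eq_one]
    exact fun h ↦ absurd h (ne_of_lt (by simpa using hpO))
  -- the ordinary filtration at level `p^k`
  have hordA := W.exists_zsmul_eq_zero_localRed_ne_zero (specVal_spec v) hΔu red (fun _ ↦ rfl)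
    hpv hΔ hord
  obtain ⟨hgenr, -, -⟩ := W.localRed_ordinary_filtration hΔu red (fun _ ↦ rfl) hordA
  obtain ⟨P, hPred, hPord, hPgen⟩ := hgenr k
  have hPtor : ((p ^ k : ℕ) : ℤ) • P = 0 := by
    rw [natCast_zsmul, ← hPord, addOrderOf_nsmul_eq_zero]
  -- inertia acts by scalars on `P` and trivially on `E(K̄_v)[p^k] / ℤ P`
  have hsc : ∀ σ : absoluteGaloisGroup (v.adicCompletion ℚ), ∃ cσ : ℕ,
      σ ∈ absInertia (v.adicCompletion ℚ) → σ • P = cσ • P := by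
    intro σ
    by_cases hσ : σ ∈ absInertia (v.adicCompletion ℚ)
    · have hσp : ((p ^ k : ℕ) : ℤ) • (σ • P) = σ • (((p ^ k : ℕ) : ℤ) • P) :=
        (map_zsmul (DistribSMul.toAddMonoidHom (localPoints W (v.adicCompletion ℚ)) σ) _ P).symm
      obtain ⟨cσ, h⟩ := hPgen (σ • P)
        (by rw [hred, localRed_smul_of_mem_absInertia W p hpv hΔ hσ, ← hred, hPred])
        (by rw [hσp, hPtor, smul_zero])
      exact ⟨cσ, fun _ ↦ h⟩
    · exact ⟨0, fun h ↦ absurd h hσ⟩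
  choose c hc using hsc
  have h2 : ∀ σ ∈ (absInertia (v.adicCompletion ℚ) : Set (absoluteGaloisGroup (v.adicCompletion ℚ))),
      ∀ Q : localPoints W (v.adicCompletion ℚ), ((p ^ k : ℕ) : ℤ) • Q = 0 →
        ∃ d : ℕ, σ • Q - (fun _ ↦ (1 : ℕ)) σ • Q = d • P := by
    intro σ hσ Q hQ
    have hσQ : ((p ^ k : ℕ) : ℤ) • (σ • Q) = σ • (((p ^ k : ℕ) : ℤ) • Q) :=
      (map_zsmul (DistribSMul.toAddMonoidHom (localPoints W (v.adicCompletion ℚ)) σ) _ Q).symm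
    obtain ⟨d, hd⟩ := hPgen (σ • Q - Q)
      (by rw [map_sub, hred, localRed_smul_of_mem_absInertia W p hpv hΔ hσ, sub_self])
      (by rw [smul_sub, hσQ, hQ, smul_zero, sub_zero])
    exact ⟨d, by rw [one_smul]; exact hd⟩
  -- the Weil pairing: a primitive `p^k`-th root of unity on which inertia acts by the same scalars
  obtain ⟨ζ, hζ, hζσ⟩ := @WeierstrassCurve.localPoints_exists_isPrimitiveRoot_smul_eq_pow ℚ _ W _
    (v.adicCompletion ℚ) _ _
    (charZero_of_injective_algebraMap (algebraMap ℚ (v.adicCompletion ℚ)).injective) p _ k P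
    hPord (absInertia (v.adicCompletion ℚ) : Set (absoluteGaloisGroup (v.adicCompletion ℚ)))
    c (fun _ ↦ 1) (fun σ hσ ↦ hc σ hσ) h2
  refine ⟨P, hPred, hPord, hPgen, fun σ hσ ↦ ?_⟩
  -- compare exponents on `ζ`: `c σ ≡ χ_p(σ) (mod p^k)`
  set e : ℕ := ((GaloisRep.cyclotomicCharacter (v.adicCompletion ℚ) p σ).val.toZModPow k).val
    with he
  have helt : e < p ^ k := ZMod.val_lt _
  have hσζ : σ • ζ = ζ ^ e :=
    GaloisRep.cyclotomicCharacter_spec (v.adicCompletion ℚ) p σ ζ hζ.pow_eq_one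
  have hcmp : ζ ^ (c σ % p ^ k) = ζ ^ e := by
    rw [← hσζ, hζσ σ hσ, one_mul, hζ.eq_orderOf, pow_mod_orderOf]
  have hmod : c σ % p ^ k = e := hζ.pow_inj (Nat.mod_lt _ (pow_pos hp.out.pos k)) helt hcmp
  rw [hc σ hσ, ← hmod, ← hPord, mod_addOrderOf_nsmul]

/-- **Every unit scalar on the level-`p^k` ordinary line is realised by inertia.** Same data, and
for `u ∈ ℕ` with `p ∤ u` an element `σ` of the local inertia group with `σ P_k = u • P_k`
(`χ_p(I_{ℚ_v}) = ℤ_p^×`, local Kronecker–Weber). [cite: GreenbergVatsal2000, §2 p. 26]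
[cite: SerreLocalFields1979, Ch. IV §4 Prop. 17] -/
theorem exists_generator_and_inertia_smul_eq_of_not_dvd (hpv : ((p : ℕ) : 𝓞 ℚ) ∈ v.asIdeal)
    (hΔ : ¬ (p : ℤ) ∣ minimalDiscriminantInt W) (hord : ¬ (p : ℤ) ∣ W.frobeniusTrace p) (k : ℕ)
    {u : ℕ} (hu : ¬ p ∣ u) :
    ∃ P : localPoints W (v.adicCompletion ℚ),
      localRed W p hpv hΔ P = 0 ∧ addOrderOf P = p ^ k ∧
      (∀ Q : localPoints W (v.adicCompletion ℚ), localRed W p hpv hΔ Q = 0 →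
        ((p ^ k : ℕ) : ℤ) • Q = 0 → ∃ j : ℕ, Q = j • P) ∧
      (∀ σ ∈ absInertia (v.adicCompletion ℚ), ∃ cσ : ℕ, σ • P = cσ • P) ∧
      ∃ σ ∈ absInertia (v.adicCompletion ℚ), σ • P = u • P := by
  obtain ⟨P, hPred, hPord, hPgen, hχ⟩ :=
    exists_generator_inertia_smul_eq_cyclotomicCharacter W p hpv hΔ hord k
  -- `u` is a `p`-adic unit
  have huunit : IsUnit ((u : ℕ) : ℤ_[p]) := by
    rw [PadicInt.isUnit_iff]
    refine le_antisymm (PadicInt.norm_le_one _) (not_lt.mp fun hlt ↦ ?_)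
    have hlt' : ‖(((u : ℕ) : ℤ) : ℤ_[p])‖ < 1 := by exact_mod_cast hlt
    have hdvd : (p : ℤ) ∣ ((u : ℕ) : ℤ) := (PadicInt.norm_int_lt_one_iff_dvd _).mp hlt'
    exact hu (by exact_mod_cast hdvd)
  have hvp : (Rat.HeightOneSpectrum.primesEquiv v : ℕ) = p :=
    Rat.HeightOneSpectrum.primesEquiv_eq_of_natCast_mem v hp.out hpv
  obtain ⟨σ₀, hσ₀I, hχσ₀⟩ :=
    adicCompletion_rat_exists_mem_absInertia_cyclotomicCharacter_eq p v hvp huunit.unit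
  refine ⟨P, hPred, hPord, hPgen, fun σ hσ ↦ ⟨_, hχ σ hσ⟩, σ₀, hσ₀I, ?_⟩
  rw [hχ σ₀ hσ₀I, hχσ₀, IsUnit.unit_spec, map_natCast, ZMod.val_natCast, ← hPord,
    mod_addOrderOf_nsmul]

/-- **The scalar `1 + p` on the ordinary line is realised by inertia** (an element of infinite order
of `Aut C ≅ ℤ_p^×` for odd `p`): same data with `σ₁ P_k = (1 + p) • P_k`. Input of the uniqueness of
the ramified ordinary line. [cite: GreenbergVatsal2000, §2 p. 26] [cite: SerreLocalFields1979, Ch. IV §4 Prop. 17] -/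
theorem exists_generator_and_inertia_smul_eq_one_add (hpv : ((p : ℕ) : 𝓞 ℚ) ∈ v.asIdeal)
    (hΔ : ¬ (p : ℤ) ∣ minimalDiscriminantInt W) (hord : ¬ (p : ℤ) ∣ W.frobeniusTrace p) (k : ℕ) :
    ∃ P : localPoints W (v.adicCompletion ℚ),
      localRed W p hpv hΔ P = 0 ∧ addOrderOf P = p ^ k ∧
      (∀ Q : localPoints W (v.adicCompletion ℚ), localRed W p hpv hΔ Q = 0 →
        ((p ^ k : ℕ) : ℤ) • Q = 0 → ∃ j : ℕ, Q = j • P) ∧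
      (∀ σ ∈ absInertia (v.adicCompletion ℚ), ∃ cσ : ℕ, σ • P = cσ • P) ∧
      ∃ σ ∈ absInertia (v.adicCompletion ℚ), σ • P = (1 + p) • P :=
  exists_generator_and_inertia_smul_eq_of_not_dvd W p hpv hΔ hord k
    (u := 1 + p) (fun h ↦ hp.out.ne_one (Nat.dvd_one.mp ((Nat.dvd_add_right (dvd_refl p)).mp
      (by rwa [add_comm] at h))))

end Summit.BirchSwinnertonDyer.Rank1Residual.GaloisImage.OrdinaryLineInertiaCyclotomic

end
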